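import Summits.BirchSwinnertonDyer.BirchSwinnertonDyer.Theorems.KatoDescentPotSupersingularWildUpperUnitTwistRecordsSharpTam14
import Summits.BirchSwinnertonDyer.BirchSwinnertonDyer.Theorems.KatoDescentPotSupersingularWildUpperUnitTwistRecordsSharpTam15
import Literature.NumberTheory.EllipticCurves.ModThreeImageCubeDiscriminantProofs
import HarnessLib

/-!
# Route `KatoDescentPotSupersingular` (rung K9, sub-rung B5 = O6 wild `p = 3`, cell `bsd-potss`): MOD-3 IMAGE KERNEL UPGRADE of the ♯
# unit-twist records on the CARTAN rows — «`ρ̄_(E,3)` NOT onto» IN THE KERNEL from `Δ(E)` being a CUBE, so that the displayed binder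
# `hns` (3-adic tower not onto) is DISCHARGED on top of the Tamagawa upgrade (part 10: 487350ex1@3, 487350fs1@3, 487350fv1@3, 28566bh1@3, 32670l1@3, 150282bh1@3)
# (seat `bsd-potss-k9-c4` g17; `--supports stmt-BirchSwinnertonDyer-19197 --as helper`)

HONEST FRAMING. THEOREMS ONLY (no definition, no named fact, no `sorry`); PER PAIR; nothing booked; items 19189 / 19197 / 21422 stay
OPEN class-wide; BSD is not proved for any class.  The ♯ records display `hns : ¬ ∀ n, ρ̄_(E,3ⁿ) onto` — the row's mod-3 image
type (normaliser of a split / non-split Cartan) was so far a CENSUS DATUM (conjA-anchor g9 ROW-STATUS / kmc g21), not re-derived.  On a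
Cartan row the mod-3 image has order prime to 3, so `ℚ(∛Δ) ⊂ ℚ(E[3])` (Serre 1972 §5.3) forces `Δ(E) ∈ ℚ׳`; conversely the tree
THEOREM `ModThreeImage.not_hasSurjectiveModNGaloisRep_three_of_Δ_eq_cube` (`Literature/…/ModThreeImageCubeDiscriminantProofs`, PROVED,
no named fact) gives `Δ = s³ ⟹ ρ̄_(E,3)` not surjective, hence `hns`.  Per row below: `notSurjThree_g<label>` (`Δ(E₀) = s³` for the
literal integral model, `decide +kernel` + `norm_num`) and `missingUpperBoundAt_g<label>_3_img` = the Tamagawa-upgraded record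
`missingUpperBoundAt_g<label>_3_tam` (files `…RecordsSharpTamNN`, this seat) with `hns` REMOVED as well.  After this upgrade a ♯ record's
displayed row data are: the named facts + the schema, Cremona's `N`, `r_an = 0`, the lattice-optimal datum with `3 ∤ c(D)`, the field,
and the twist numerics — the image type and the Tamagawa data are kernel facts.  (The 9-deficient rows — `GL₂(𝔽₃)` onto mod 3, tower not
onto mod 9 — are NOT covered: `Δ` is not a cube there; their `hns` stays displayed.)

References: [Serre1972] §5.3; [SilvermanAEC2009] III.1, VII.1 Rem. 1.1; [Zywina2015ModL] §1 (images of ρ̄_(E,3)); [Jetchev2008] Cor. 1.5;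
[Miller2011LMS] Def. 1.1; [Cremona2006] Table 1.
-/

set_option autoImplicit false
set_option linter.dupNamespace false
noncomputable section
open scoped Classical NumberField
open WeierstrassCurve NumberField Field
  Literature.NumberTheory.EllipticCurves
  Literature.NumberTheory.EllipticCurves.ModularForms Literature.NumberTheory.EllipticCurves.Rank1Residual
  Literature.NumberTheory.EllipticCurves.Rank1Residual.Typed Literature.NumberTheory.Automorphic
  Literature.NumberTheory.EllipticCurves.Rank1Residual.X11RankOneCertificates
  Summit.BirchSwinnertonDyer.BirchSwinnertonDyer.Rank1Residual.IntModel
  Summit.BirchSwinnertonDyer.BirchSwinnertonDyer.Rank1Residual.X11RankOne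
  Summit.BirchSwinnertonDyer.Rank1Residual Summit.BirchSwinnertonDyer.Rank1Residual.Additive
  Summit.BirchSwinnertonDyer.BirchSwinnertonDyer.Theorems

namespace Summit.BirchSwinnertonDyer.BirchSwinnertonDyer.Theorems.WildUpperUnitTwistRecords

/-! ### `487350ex1`: `Δ = 283127467474944000000 = (6566400)³` — mod-3 image inside a Cartan normaliser, certified in the kernel -/

/-- **`ρ̄_(E,3)` is NOT surjective for `E = 487350ex1`** (kernel: `Δ(E) = (6566400)³` on the integral model `[1, -1, 1, -3952505, -2913174503]`; Serre: `ℚ(E[3]) ⊇ ℚ(μ₃, ∛Δ)`, so a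
surjective image forces `Δ ∉ ℚ׳`; tree THEOREM `ModThreeImage.not_hasSurjectiveModNGaloisRep_three_of_Δ_eq_cube`). [cite: Serre1972, §5.3]
[cite: SilvermanAEC2009, III.1] [cite: Cremona2006, Table 1 (Cremona label 487350ex1)] -/
theorem notSurjThree_g487350ex1 {W : WeierstrassCurve ℚ} [W.IsElliptic] [W.IsGloballyMinimal]
    (hI : integralModelInt W = (⟨1, -1, 1, -3952505, -2913174503⟩ : WeierstrassCurve ℤ)) : ¬ W.HasSurjectiveModNGaloisRep 3 := by
  have hD : discOf [1, (-1), 1, (-3952505), (-2913174503)] = 283127467474944000000 := by decide +kernel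
  have hΔ : W.Δ = ((283127467474944000000 : ℤ) : ℚ) := by rw [Δ_eq_cast hI, intCurve_Δ, hD]
  exact ModThreeImage.not_hasSurjectiveModNGaloisRep_three_of_Δ_eq_cube W (d := ((6566400 : ℤ) : ℚ)) (by rw [hΔ]; norm_num)

/-- **RECORD `487350ex1` @ `3` with the image binder `hns` AND the Tamagawa binders DISCHARGED** — `missingUpperBoundAt_g487350ex1_3_tam` (file
`…RecordsSharpTam14`) with `hns` supplied by `notSurjThree_g487350ex1` (`n = 1`). Remaining displayed: named facts + schema, Cremona's `N`, `r_an = 0`,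
the lattice-optimal datum with `3 ∤ c(D)`, the field, the twist numerics. Per pair; nothing booked; BSD is not proved by this.
[cite: Serre1972, §5.3] [cite: Jetchev2008, Cor. 1.5] [cite: Miller2011LMS, Def. 1.1] [cite: Cremona2006, Table 1 (Cremona label 487350ex1)] -/
theorem missingUpperBoundAt_g487350ex1_3_img
    (hGZ : ∀ (N : ℕ) [NeZero N] (W : WeierstrassCurve ℚ) (K : Type) [Field K] [NumberField K],
      gross_zagier N W K)
    (hKo : ∀ (N : ℕ) [NeZero N] (W : WeierstrassCurve ℚ) (K : Type) [Field K] [NumberField K],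
      kolyvagin N W K)
    (hMN : ∀ (N : ℕ) [NeZero N] (W : WeierstrassCurve ℚ) (K : Type) [Field K] [NumberField K],
      MatarNekovar2019.thm03_padicValNat_card_sha_le_of_irreducible N W K)
    (hGZK : rank_eq_analyticRank_of_analyticRank_le_one) (hmod : hasEntireLFunction_rat)
    (hJ2 : ∀ (N : ℕ) [NeZero N] (W : WeierstrassCurve ℚ) [W.IsElliptic] [W.IsGloballyMinimal]
      (K : Type) [Field K] [NumberField K],
      IsImaginaryQuadratic K → NumberField.discr K ≠ -3 → NumberField.discr K ≠ -4 →
      SatisfiesHeegnerHypothesis N K → SatisfiesHeegnerHypothesis 2 K →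
      ∀ (p : ℕ) [Fact p.Prime], p ≠ 2 → W.analyticRank = 0 → Addv W p → 0 ≤ padicValRat p W.j →
      ¬ W.HasCM → W.HasIrreducibleModPGaloisRep p →
      ¬ (∀ n : ℕ, W.HasSurjectiveModNGaloisRep (p ^ n : ℕ)) →
      (∃ Dt : ModularParametrizationData W N,
        (∀ z ∈ Dt.L.lattice, ∃ w ∈ periodLattice Dt.f, z = (Dt.c : ℂ) * w) ∧ ¬ (p : ℤ) ∣ Dt.c) →
      ¬ p ∣ (W.baseChange ℚ_[p]).localTamagawaNumber ℤ_[p] →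
      (∀ (q' : ℕ) [Fact q'.Prime], q' ∣ N →
        p ∣ (W.baseChange ℚ_[q']).localTamagawaNumber ℤ_[q'] → ¬ q' ^ 2 ∣ N) →
      ∀ {P : (W.baseChange K).toAffine.Point}, IsHeegnerPoint N W K P → ¬ IsOfFinAddOrder P →
      ∀ (q : ℕ) [Fact q.Prime], q ∣ N → ¬ q ^ 2 ∣ N → q ≠ p →
      padicValNat p (Nat.card (AddCommGroup.primaryComponent (W.baseChange K).sha p)) +
          2 * padicValNat p ((W.baseChange ℚ_[q]).localTamagawaNumber ℤ_[q]) ≤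
        2 * padicValNat p (AddSubgroup.zmultiples P).index)
    {W : WeierstrassCurve ℚ} [W.IsElliptic] [W.IsGloballyMinimal] (hWeq : W = (⟨1, (-1), 1, (-3952505), (-2913174503)⟩ : WeierstrassCurve ℚ))
    (hN : W.conductorNorm ℤ = 487350) (hr : W.analyticRank = 0)
    (D : ModularParametrizationData W 487350) (hopt : ∀ z ∈ D.L.lattice, ∃ w ∈ periodLattice D.f, z = (D.c : ℂ) * w)
    (hc : ¬ (3 : ℤ) ∣ D.c)
    (K : Type) [Field K] [NumberField K] (hK : IsImaginaryQuadratic K) (hdK : NumberField.discr K = -71)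
    {Wd : WeierstrassCurve ℚ} [Wd.IsElliptic] [Wd.IsGloballyMinimal] (hWdeq : Wd = (⟨1, (-1), 1, (-19924576130), 1043015841818497⟩ : WeierstrassCurve ℚ))
    (hrd : Wd.analyticRank = 1) {qd : ℚ} (hqd : shaAn Wd = (qd : ℂ)) (hvd : padicValRat 3 qd ≤ 0) :
    MissingUpperBoundAt W 3 := by
  have hI : integralModelInt W = (⟨1, -1, 1, -3952505, -2913174503⟩ : WeierstrassCurve ℤ) := by
    subst hWeq; exact integralModelInt_eq_of_map_eq _ (map_mk_int 1 (-1) 1 (-3952505) (-2913174503))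
  have hns : ¬ (∀ n : ℕ, W.HasSurjectiveModNGaloisRep (3 ^ n : ℕ)) := fun h =>
    notSurjThree_g487350ex1 hI (by simpa using h 1)
  exact missingUpperBoundAt_g487350ex1_3_tam hGZ hKo hMN hGZK hmod hJ2 hWeq hN hr hns D hopt hc K hK hdK hWdeq hrd hqd hvd

/-! ### `487350fs1`: `Δ = -4460834734096896000 = (-1646160)³` — mod-3 image inside a Cartan normaliser, certified in the kernel -/

/-- **`ρ̄_(E,3)` is NOT surjective for `E = 487350fs1`** (kernel: `Δ(E) = (-1646160)³` on the integral model `[1, -1, 1, 315085, -75522413]`; Serre: `ℚ(E[3]) ⊇ ℚ(μ₃, ∛Δ)`, so a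
surjective image forces `Δ ∉ ℚ׳`; tree THEOREM `ModThreeImage.not_hasSurjectiveModNGaloisRep_three_of_Δ_eq_cube`). [cite: Serre1972, §5.3]
[cite: SilvermanAEC2009, III.1] [cite: Cremona2006, Table 1 (Cremona label 487350fs1)] -/
theorem notSurjThree_g487350fs1 {W : WeierstrassCurve ℚ} [W.IsElliptic] [W.IsGloballyMinimal]
    (hI : integralModelInt W = (⟨1, -1, 1, 315085, -75522413⟩ : WeierstrassCurve ℤ)) : ¬ W.HasSurjectiveModNGaloisRep 3 := by
  have hD : discOf [1, (-1), 1, 315085, (-75522413)] = (-4460834734096896000) := by decide +kernel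
  have hΔ : W.Δ = (((-4460834734096896000) : ℤ) : ℚ) := by rw [Δ_eq_cast hI, intCurve_Δ, hD]
  exact ModThreeImage.not_hasSurjectiveModNGaloisRep_three_of_Δ_eq_cube W (d := (((-1646160) : ℤ) : ℚ)) (by rw [hΔ]; norm_num)

/-- **RECORD `487350fs1` @ `3` with the image binder `hns` AND the Tamagawa binders DISCHARGED** — `missingUpperBoundAt_g487350fs1_3_tam` (file
`…RecordsSharpTam14`) with `hns` supplied by `notSurjThree_g487350fs1` (`n = 1`). Remaining displayed: named facts + schema, Cremona's `N`, `r_an = 0`,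
the lattice-optimal datum with `3 ∤ c(D)`, the field, the twist numerics. Per pair; nothing booked; BSD is not proved by this.
[cite: Serre1972, §5.3] [cite: Jetchev2008, Cor. 1.5] [cite: Miller2011LMS, Def. 1.1] [cite: Cremona2006, Table 1 (Cremona label 487350fs1)] -/
theorem missingUpperBoundAt_g487350fs1_3_img
    (hGZ : ∀ (N : ℕ) [NeZero N] (W : WeierstrassCurve ℚ) (K : Type) [Field K] [NumberField K],
      gross_zagier N W K)
    (hKo : ∀ (N : ℕ) [NeZero N] (W : WeierstrassCurve ℚ) (K : Type) [Field K] [NumberField K],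
      kolyvagin N W K)
    (hMN : ∀ (N : ℕ) [NeZero N] (W : WeierstrassCurve ℚ) (K : Type) [Field K] [NumberField K],
      MatarNekovar2019.thm03_padicValNat_card_sha_le_of_irreducible N W K)
    (hGZK : rank_eq_analyticRank_of_analyticRank_le_one) (hmod : hasEntireLFunction_rat)
    (hJ2 : ∀ (N : ℕ) [NeZero N] (W : WeierstrassCurve ℚ) [W.IsElliptic] [W.IsGloballyMinimal]
      (K : Type) [Field K] [NumberField K],
      IsImaginaryQuadratic K → NumberField.discr K ≠ -3 → NumberField.discr K ≠ -4 →
      SatisfiesHeegnerHypothesis N K → SatisfiesHeegnerHypothesis 2 K →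
      ∀ (p : ℕ) [Fact p.Prime], p ≠ 2 → W.analyticRank = 0 → Addv W p → 0 ≤ padicValRat p W.j →
      ¬ W.HasCM → W.HasIrreducibleModPGaloisRep p →
      ¬ (∀ n : ℕ, W.HasSurjectiveModNGaloisRep (p ^ n : ℕ)) →
      (∃ Dt : ModularParametrizationData W N,
        (∀ z ∈ Dt.L.lattice, ∃ w ∈ periodLattice Dt.f, z = (Dt.c : ℂ) * w) ∧ ¬ (p : ℤ) ∣ Dt.c) →
      ¬ p ∣ (W.baseChange ℚ_[p]).localTamagawaNumber ℤ_[p] →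
      (∀ (q' : ℕ) [Fact q'.Prime], q' ∣ N →
        p ∣ (W.baseChange ℚ_[q']).localTamagawaNumber ℤ_[q'] → ¬ q' ^ 2 ∣ N) →
      ∀ {P : (W.baseChange K).toAffine.Point}, IsHeegnerPoint N W K P → ¬ IsOfFinAddOrder P →
      ∀ (q : ℕ) [Fact q.Prime], q ∣ N → ¬ q ^ 2 ∣ N → q ≠ p →
      padicValNat p (Nat.card (AddCommGroup.primaryComponent (W.baseChange K).sha p)) +
          2 * padicValNat p ((W.baseChange ℚ_[q]).localTamagawaNumber ℤ_[q]) ≤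
        2 * padicValNat p (AddSubgroup.zmultiples P).index)
    {W : WeierstrassCurve ℚ} [W.IsElliptic] [W.IsGloballyMinimal] (hWeq : W = (⟨1, (-1), 1, 315085, (-75522413)⟩ : WeierstrassCurve ℚ))
    (hN : W.conductorNorm ℤ = 487350) (hr : W.analyticRank = 0)
    (D : ModularParametrizationData W 487350) (hopt : ∀ z ∈ D.L.lattice, ∃ w ∈ periodLattice D.f, z = (D.c : ℂ) * w)
    (hc : ¬ (3 : ℤ) ∣ D.c)
    (K : Type) [Field K] [NumberField K] (hK : IsImaginaryQuadratic K) (hdK : NumberField.discr K = -71)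
    {Wd : WeierstrassCurve ℚ} [Wd.IsElliptic] [Wd.IsGloballyMinimal] (hWdeq : Wd = (⟨1, (-1), 1, 1588345060, 27001712053087⟩ : WeierstrassCurve ℚ))
    (hrd : Wd.analyticRank = 1) {qd : ℚ} (hqd : shaAn Wd = (qd : ℂ)) (hvd : padicValRat 3 qd ≤ 0) :
    MissingUpperBoundAt W 3 := by
  have hI : integralModelInt W = (⟨1, -1, 1, 315085, -75522413⟩ : WeierstrassCurve ℤ) := by
    subst hWeq; exact integralModelInt_eq_of_map_eq _ (map_mk_int 1 (-1) 1 315085 (-75522413))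
  have hns : ¬ (∀ n : ℕ, W.HasSurjectiveModNGaloisRep (3 ^ n : ℕ)) := fun h =>
    notSurjThree_g487350fs1 hI (by simpa using h 1)
  exact missingUpperBoundAt_g487350fs1_3_tam hGZ hKo hMN hGZK hmod hJ2 hWeq hN hr hns D hopt hc K hK hdK hWdeq hrd hqd hvd

/-! ### `487350fv1`: `Δ = -136133872500515625000 = (-5144250)³` — mod-3 image inside a Cartan normaliser, certified in the kernel -/

/-- **`ρ̄_(E,3)` is NOT surjective for `E = 487350fv1`** (kernel: `Δ(E) = (-5144250)³` on the integral model `[1, -1, 1, -1125305, -725138303]`; Serre: `ℚ(E[3]) ⊇ ℚ(μ₃, ∛Δ)`, so a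
surjective image forces `Δ ∉ ℚ׳`; tree THEOREM `ModThreeImage.not_hasSurjectiveModNGaloisRep_three_of_Δ_eq_cube`). [cite: Serre1972, §5.3]
[cite: SilvermanAEC2009, III.1] [cite: Cremona2006, Table 1 (Cremona label 487350fv1)] -/
theorem notSurjThree_g487350fv1 {W : WeierstrassCurve ℚ} [W.IsElliptic] [W.IsGloballyMinimal]
    (hI : integralModelInt W = (⟨1, -1, 1, -1125305, -725138303⟩ : WeierstrassCurve ℤ)) : ¬ W.HasSurjectiveModNGaloisRep 3 := by
  have hD : discOf [1, (-1), 1, (-1125305), (-725138303)] = (-136133872500515625000) := by decide +kernel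
  have hΔ : W.Δ = (((-136133872500515625000) : ℤ) : ℚ) := by rw [Δ_eq_cast hI, intCurve_Δ, hD]
  exact ModThreeImage.not_hasSurjectiveModNGaloisRep_three_of_Δ_eq_cube W (d := (((-5144250) : ℤ) : ℚ)) (by rw [hΔ]; norm_num)

/-- **RECORD `487350fv1` @ `3` with the image binder `hns` AND the Tamagawa binders DISCHARGED** — `missingUpperBoundAt_g487350fv1_3_tam` (file
`…RecordsSharpTam15`) with `hns` supplied by `notSurjThree_g487350fv1` (`n = 1`). Remaining displayed: named facts + schema, Cremona's `N`, `r_an = 0`,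
the lattice-optimal datum with `3 ∤ c(D)`, the field, the twist numerics. Per pair; nothing booked; BSD is not proved by this.
[cite: Serre1972, §5.3] [cite: Jetchev2008, Cor. 1.5] [cite: Miller2011LMS, Def. 1.1] [cite: Cremona2006, Table 1 (Cremona label 487350fv1)] -/
theorem missingUpperBoundAt_g487350fv1_3_img
    (hGZ : ∀ (N : ℕ) [NeZero N] (W : WeierstrassCurve ℚ) (K : Type) [Field K] [NumberField K],
      gross_zagier N W K)
    (hKo : ∀ (N : ℕ) [NeZero N] (W : WeierstrassCurve ℚ) (K : Type) [Field K] [NumberField K],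
      kolyvagin N W K)
    (hMN : ∀ (N : ℕ) [NeZero N] (W : WeierstrassCurve ℚ) (K : Type) [Field K] [NumberField K],
      MatarNekovar2019.thm03_padicValNat_card_sha_le_of_irreducible N W K)
    (hGZK : rank_eq_analyticRank_of_analyticRank_le_one) (hmod : hasEntireLFunction_rat)
    (hJ2 : ∀ (N : ℕ) [NeZero N] (W : WeierstrassCurve ℚ) [W.IsElliptic] [W.IsGloballyMinimal]
      (K : Type) [Field K] [NumberField K],
      IsImaginaryQuadratic K → NumberField.discr K ≠ -3 → NumberField.discr K ≠ -4 →
      SatisfiesHeegnerHypothesis N K → SatisfiesHeegnerHypothesis 2 K →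
      ∀ (p : ℕ) [Fact p.Prime], p ≠ 2 → W.analyticRank = 0 → Addv W p → 0 ≤ padicValRat p W.j →
      ¬ W.HasCM → W.HasIrreducibleModPGaloisRep p →
      ¬ (∀ n : ℕ, W.HasSurjectiveModNGaloisRep (p ^ n : ℕ)) →
      (∃ Dt : ModularParametrizationData W N,
        (∀ z ∈ Dt.L.lattice, ∃ w ∈ periodLattice Dt.f, z = (Dt.c : ℂ) * w) ∧ ¬ (p : ℤ) ∣ Dt.c) →
      ¬ p ∣ (W.baseChange ℚ_[p]).localTamagawaNumber ℤ_[p] →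
      (∀ (q' : ℕ) [Fact q'.Prime], q' ∣ N →
        p ∣ (W.baseChange ℚ_[q']).localTamagawaNumber ℤ_[q'] → ¬ q' ^ 2 ∣ N) →
      ∀ {P : (W.baseChange K).toAffine.Point}, IsHeegnerPoint N W K P → ¬ IsOfFinAddOrder P →
      ∀ (q : ℕ) [Fact q.Prime], q ∣ N → ¬ q ^ 2 ∣ N → q ≠ p →
      padicValNat p (Nat.card (AddCommGroup.primaryComponent (W.baseChange K).sha p)) +
          2 * padicValNat p ((W.baseChange ℚ_[q]).localTamagawaNumber ℤ_[q]) ≤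
        2 * padicValNat p (AddSubgroup.zmultiples P).index)
    {W : WeierstrassCurve ℚ} [W.IsElliptic] [W.IsGloballyMinimal] (hWeq : W = (⟨1, (-1), 1, (-1125305), (-725138303)⟩ : WeierstrassCurve ℚ))
    (hN : W.conductorNorm ℤ = 487350) (hr : W.analyticRank = 0)
    (D : ModularParametrizationData W 487350) (hopt : ∀ z ∈ D.L.lattice, ∃ w ∈ periodLattice D.f, z = (D.c : ℂ) * w)
    (hc : ¬ (3 : ℤ) ∣ D.c)
    (K : Type) [Field K] [NumberField K] (hK : IsImaginaryQuadratic K) (hdK : NumberField.discr K = -431)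
    {Wd : WeierstrassCurve ℚ} [Wd.IsElliptic] [Wd.IsGloballyMinimal] (hWdeq : Wd = (⟨1, (-1), 1, (-209037724055), 58079317479775447⟩ : WeierstrassCurve ℚ))
    (hrd : Wd.analyticRank = 1) {qd : ℚ} (hqd : shaAn Wd = (qd : ℂ)) (hvd : padicValRat 3 qd ≤ 0) :
    MissingUpperBoundAt W 3 := by
  have hI : integralModelInt W = (⟨1, -1, 1, -1125305, -725138303⟩ : WeierstrassCurve ℤ) := by
    subst hWeq; exact integralModelInt_eq_of_map_eq _ (map_mk_int 1 (-1) 1 (-1125305) (-725138303))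
  have hns : ¬ (∀ n : ℕ, W.HasSurjectiveModNGaloisRep (3 ^ n : ℕ)) := fun h =>
    notSurjThree_g487350fv1 hI (by simpa using h 1)
  exact missingUpperBoundAt_g487350fv1_3_tam hGZ hKo hMN hGZK hmod hJ2 hWeq hN hr hns D hopt hc K hK hdK hWdeq hrd hqd hvd

/-! ### `28566bh1`: `Δ = -389048974876008 = (-73002)³` — mod-3 image inside a Cartan normaliser, certified in the kernel -/

/-- **`ρ̄_(E,3)` is NOT surjective for `E = 28566bh1`** (kernel: `Δ(E) = (-73002)³` on the integral model `[1, -1, 1, -34220, 2623319]`; Serre: `ℚ(E[3]) ⊇ ℚ(μ₃, ∛Δ)`, so a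
surjective image forces `Δ ∉ ℚ׳`; tree THEOREM `ModThreeImage.not_hasSurjectiveModNGaloisRep_three_of_Δ_eq_cube`). [cite: Serre1972, §5.3]
[cite: SilvermanAEC2009, III.1] [cite: Cremona2006, Table 1 (Cremona label 28566bh1)] -/
theorem notSurjThree_g28566bh1 {W : WeierstrassCurve ℚ} [W.IsElliptic] [W.IsGloballyMinimal]
    (hI : integralModelInt W = (⟨1, -1, 1, -34220, 2623319⟩ : WeierstrassCurve ℤ)) : ¬ W.HasSurjectiveModNGaloisRep 3 := by
  have hD : discOf [1, (-1), 1, (-34220), 2623319] = (-389048974876008) := by decide +kernel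
  have hΔ : W.Δ = (((-389048974876008) : ℤ) : ℚ) := by rw [Δ_eq_cast hI, intCurve_Δ, hD]
  exact ModThreeImage.not_hasSurjectiveModNGaloisRep_three_of_Δ_eq_cube W (d := (((-73002) : ℤ) : ℚ)) (by rw [hΔ]; norm_num)

/-- **RECORD `28566bh1` @ `3` with the image binder `hns` AND the Tamagawa binders DISCHARGED** — `missingUpperBoundAt_g28566bh1_3_tam` (file
`…RecordsSharpTam15`) with `hns` supplied by `notSurjThree_g28566bh1` (`n = 1`). Remaining displayed: named facts + schema, Cremona's `N`, `r_an = 0`,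
the lattice-optimal datum with `3 ∤ c(D)`, the field, the twist numerics. Per pair; nothing booked; BSD is not proved by this.
[cite: Serre1972, §5.3] [cite: Jetchev2008, Cor. 1.5] [cite: Miller2011LMS, Def. 1.1] [cite: Cremona2006, Table 1 (Cremona label 28566bh1)] -/
theorem missingUpperBoundAt_g28566bh1_3_img
    (hGZ : ∀ (N : ℕ) [NeZero N] (W : WeierstrassCurve ℚ) (K : Type) [Field K] [NumberField K],
      gross_zagier N W K)
    (hKo : ∀ (N : ℕ) [NeZero N] (W : WeierstrassCurve ℚ) (K : Type) [Field K] [NumberField K],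
      kolyvagin N W K)
    (hMN : ∀ (N : ℕ) [NeZero N] (W : WeierstrassCurve ℚ) (K : Type) [Field K] [NumberField K],
      MatarNekovar2019.thm03_padicValNat_card_sha_le_of_irreducible N W K)
    (hGZK : rank_eq_analyticRank_of_analyticRank_le_one) (hmod : hasEntireLFunction_rat)
    (hJ2 : ∀ (N : ℕ) [NeZero N] (W : WeierstrassCurve ℚ) [W.IsElliptic] [W.IsGloballyMinimal]
      (K : Type) [Field K] [NumberField K],
      IsImaginaryQuadratic K → NumberField.discr K ≠ -3 → NumberField.discr K ≠ -4 →
      SatisfiesHeegnerHypothesis N K → SatisfiesHeegnerHypothesis 2 K →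
      ∀ (p : ℕ) [Fact p.Prime], p ≠ 2 → W.analyticRank = 0 → Addv W p → 0 ≤ padicValRat p W.j →
      ¬ W.HasCM → W.HasIrreducibleModPGaloisRep p →
      ¬ (∀ n : ℕ, W.HasSurjectiveModNGaloisRep (p ^ n : ℕ)) →
      (∃ Dt : ModularParametrizationData W N,
        (∀ z ∈ Dt.L.lattice, ∃ w ∈ periodLattice Dt.f, z = (Dt.c : ℂ) * w) ∧ ¬ (p : ℤ) ∣ Dt.c) →
      ¬ p ∣ (W.baseChange ℚ_[p]).localTamagawaNumber ℤ_[p] →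
      (∀ (q' : ℕ) [Fact q'.Prime], q' ∣ N →
        p ∣ (W.baseChange ℚ_[q']).localTamagawaNumber ℤ_[q'] → ¬ q' ^ 2 ∣ N) →
      ∀ {P : (W.baseChange K).toAffine.Point}, IsHeegnerPoint N W K P → ¬ IsOfFinAddOrder P →
      ∀ (q : ℕ) [Fact q.Prime], q ∣ N → ¬ q ^ 2 ∣ N → q ≠ p →
      padicValNat p (Nat.card (AddCommGroup.primaryComponent (W.baseChange K).sha p)) +
          2 * padicValNat p ((W.baseChange ℚ_[q]).localTamagawaNumber ℤ_[q]) ≤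
        2 * padicValNat p (AddSubgroup.zmultiples P).index)
    {W : WeierstrassCurve ℚ} [W.IsElliptic] [W.IsGloballyMinimal] (hWeq : W = (⟨1, (-1), 1, (-34220), 2623319⟩ : WeierstrassCurve ℚ))
    (hN : W.conductorNorm ℤ = 28566) (hr : W.analyticRank = 0)
    (D : ModularParametrizationData W 28566) (hopt : ∀ z ∈ D.L.lattice, ∃ w ∈ periodLattice D.f, z = (D.c : ℂ) * w)
    (hc : ¬ (3 : ℤ) ∣ D.c)
    (K : Type) [Field K] [NumberField K] (hK : IsImaginaryQuadratic K) (hdK : NumberField.discr K = -479)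
    {Wd : WeierstrassCurve ℚ} [Wd.IsElliptic] [Wd.IsGloballyMinimal] (hWdeq : Wd = (⟨1, (-1), 1, (-7851399320), (-287366492985661)⟩ : WeierstrassCurve ℚ))
    (hrd : Wd.analyticRank = 1) {qd : ℚ} (hqd : shaAn Wd = (qd : ℂ)) (hvd : padicValRat 3 qd ≤ 0) :
    MissingUpperBoundAt W 3 := by
  have hI : integralModelInt W = (⟨1, -1, 1, -34220, 2623319⟩ : WeierstrassCurve ℤ) := by
    subst hWeq; exact integralModelInt_eq_of_map_eq _ (map_mk_int 1 (-1) 1 (-34220) 2623319)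
  have hns : ¬ (∀ n : ℕ, W.HasSurjectiveModNGaloisRep (3 ^ n : ℕ)) := fun h =>
    notSurjThree_g28566bh1 hI (by simpa using h 1)
  exact missingUpperBoundAt_g28566bh1_3_tam hGZ hKo hMN hGZK hmod hJ2 hWeq hN hr hns D hopt hc K hK hdK hWdeq hrd hqd hvd

/-! ### `32670l1`: `Δ = 46411484401953000 = (359370)³` — mod-3 image inside a Cartan normaliser, certified in the kernel -/

/-- **`ρ̄_(E,3)` is NOT surjective for `E = 32670l1`** (kernel: `Δ(E) = (359370)³` on the integral model `[1, -1, 0, -114549, 10763693]`; Serre: `ℚ(E[3]) ⊇ ℚ(μ₃, ∛Δ)`, so a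
surjective image forces `Δ ∉ ℚ׳`; tree THEOREM `ModThreeImage.not_hasSurjectiveModNGaloisRep_three_of_Δ_eq_cube`). [cite: Serre1972, §5.3]
[cite: SilvermanAEC2009, III.1] [cite: Cremona2006, Table 1 (Cremona label 32670l1)] -/
theorem notSurjThree_g32670l1 {W : WeierstrassCurve ℚ} [W.IsElliptic] [W.IsGloballyMinimal]
    (hI : integralModelInt W = (⟨1, -1, 0, -114549, 10763693⟩ : WeierstrassCurve ℤ)) : ¬ W.HasSurjectiveModNGaloisRep 3 := by
  have hD : discOf [1, (-1), 0, (-114549), 10763693] = 46411484401953000 := by decide +kernel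
  have hΔ : W.Δ = ((46411484401953000 : ℤ) : ℚ) := by rw [Δ_eq_cast hI, intCurve_Δ, hD]
  exact ModThreeImage.not_hasSurjectiveModNGaloisRep_three_of_Δ_eq_cube W (d := ((359370 : ℤ) : ℚ)) (by rw [hΔ]; norm_num)

/-- **RECORD `32670l1` @ `3` with the image binder `hns` AND the Tamagawa binders DISCHARGED** — `missingUpperBoundAt_g32670l1_3_tam` (file
`…RecordsSharpTam15`) with `hns` supplied by `notSurjThree_g32670l1` (`n = 1`). Remaining displayed: named facts + schema, Cremona's `N`, `r_an = 0`,
the lattice-optimal datum with `3 ∤ c(D)`, the field, the twist numerics. Per pair; nothing booked; BSD is not proved by this.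
[cite: Serre1972, §5.3] [cite: Jetchev2008, Cor. 1.5] [cite: Miller2011LMS, Def. 1.1] [cite: Cremona2006, Table 1 (Cremona label 32670l1)] -/
theorem missingUpperBoundAt_g32670l1_3_img
    (hGZ : ∀ (N : ℕ) [NeZero N] (W : WeierstrassCurve ℚ) (K : Type) [Field K] [NumberField K],
      gross_zagier N W K)
    (hKo : ∀ (N : ℕ) [NeZero N] (W : WeierstrassCurve ℚ) (K : Type) [Field K] [NumberField K],
      kolyvagin N W K)
    (hMN : ∀ (N : ℕ) [NeZero N] (W : WeierstrassCurve ℚ) (K : Type) [Field K] [NumberField K],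
      MatarNekovar2019.thm03_padicValNat_card_sha_le_of_irreducible N W K)
    (hGZK : rank_eq_analyticRank_of_analyticRank_le_one) (hmod : hasEntireLFunction_rat)
    (hJ2 : ∀ (N : ℕ) [NeZero N] (W : WeierstrassCurve ℚ) [W.IsElliptic] [W.IsGloballyMinimal]
      (K : Type) [Field K] [NumberField K],
      IsImaginaryQuadratic K → NumberField.discr K ≠ -3 → NumberField.discr K ≠ -4 →
      SatisfiesHeegnerHypothesis N K → SatisfiesHeegnerHypothesis 2 K →
      ∀ (p : ℕ) [Fact p.Prime], p ≠ 2 → W.analyticRank = 0 → Addv W p → 0 ≤ padicValRat p W.j →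
      ¬ W.HasCM → W.HasIrreducibleModPGaloisRep p →
      ¬ (∀ n : ℕ, W.HasSurjectiveModNGaloisRep (p ^ n : ℕ)) →
      (∃ Dt : ModularParametrizationData W N,
        (∀ z ∈ Dt.L.lattice, ∃ w ∈ periodLattice Dt.f, z = (Dt.c : ℂ) * w) ∧ ¬ (p : ℤ) ∣ Dt.c) →
      ¬ p ∣ (W.baseChange ℚ_[p]).localTamagawaNumber ℤ_[p] →
      (∀ (q' : ℕ) [Fact q'.Prime], q' ∣ N →
        p ∣ (W.baseChange ℚ_[q']).localTamagawaNumber ℤ_[q'] → ¬ q' ^ 2 ∣ N) →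
      ∀ {P : (W.baseChange K).toAffine.Point}, IsHeegnerPoint N W K P → ¬ IsOfFinAddOrder P →
      ∀ (q : ℕ) [Fact q.Prime], q ∣ N → ¬ q ^ 2 ∣ N → q ≠ p →
      padicValNat p (Nat.card (AddCommGroup.primaryComponent (W.baseChange K).sha p)) +
          2 * padicValNat p ((W.baseChange ℚ_[q]).localTamagawaNumber ℤ_[q]) ≤
        2 * padicValNat p (AddSubgroup.zmultiples P).index)
    {W : WeierstrassCurve ℚ} [W.IsElliptic] [W.IsGloballyMinimal] (hWeq : W = (⟨1, (-1), 0, (-114549), 10763693⟩ : WeierstrassCurve ℚ))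
    (hN : W.conductorNorm ℤ = 32670) (hr : W.analyticRank = 0)
    (D : ModularParametrizationData W 32670) (hopt : ∀ z ∈ D.L.lattice, ∃ w ∈ periodLattice D.f, z = (D.c : ℂ) * w)
    (hc : ¬ (3 : ℤ) ∣ D.c)
    (K : Type) [Field K] [NumberField K] (hK : IsImaginaryQuadratic K) (hdK : NumberField.discr K = -431)
    {Wd : WeierstrassCurve ℚ} [Wd.IsElliptic] [Wd.IsGloballyMinimal] (hWdeq : Wd = (⟨1, (-1), 0, (-21278771619), (-859475349701875)⟩ : WeierstrassCurve ℚ))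
    (hrd : Wd.analyticRank = 1) {qd : ℚ} (hqd : shaAn Wd = (qd : ℂ)) (hvd : padicValRat 3 qd ≤ 0) :
    MissingUpperBoundAt W 3 := by
  have hI : integralModelInt W = (⟨1, -1, 0, -114549, 10763693⟩ : WeierstrassCurve ℤ) := by
    subst hWeq; exact integralModelInt_eq_of_map_eq _ (map_mk_int 1 (-1) 0 (-114549) 10763693)
  have hns : ¬ (∀ n : ℕ, W.HasSurjectiveModNGaloisRep (3 ^ n : ℕ)) := fun h =>
    notSurjThree_g32670l1 hI (by simpa using h 1)
  exact missingUpperBoundAt_g32670l1_3_tam hGZ hKo hMN hGZK hmod hJ2 hWeq hN hr hns D hopt hc K hK hdK hWdeq hrd hqd hvd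

/-! ### `150282bh1`: `Δ = -4517508245748497208 = (-1653102)³` — mod-3 image inside a Cartan normaliser, certified in the kernel -/

/-- **`ρ̄_(E,3)` is NOT surjective for `E = 150282bh1`** (kernel: `Δ(E) = (-1653102)³` on the integral model `[1, -1, 1, -3762155, 2811486835]`; Serre: `ℚ(E[3]) ⊇ ℚ(μ₃, ∛Δ)`, so a
surjective image forces `Δ ∉ ℚ׳`; tree THEOREM `ModThreeImage.not_hasSurjectiveModNGaloisRep_three_of_Δ_eq_cube`). [cite: Serre1972, §5.3]
[cite: SilvermanAEC2009, III.1] [cite: Cremona2006, Table 1 (Cremona label 150282bh1)] -/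
theorem notSurjThree_g150282bh1 {W : WeierstrassCurve ℚ} [W.IsElliptic] [W.IsGloballyMinimal]
    (hI : integralModelInt W = (⟨1, -1, 1, -3762155, 2811486835⟩ : WeierstrassCurve ℤ)) : ¬ W.HasSurjectiveModNGaloisRep 3 := by
  have hD : discOf [1, (-1), 1, (-3762155), 2811486835] = (-4517508245748497208) := by decide +kernel
  have hΔ : W.Δ = (((-4517508245748497208) : ℤ) : ℚ) := by rw [Δ_eq_cast hI, intCurve_Δ, hD]
  exact ModThreeImage.not_hasSurjectiveModNGaloisRep_three_of_Δ_eq_cube W (d := (((-1653102) : ℤ) : ℚ)) (by rw [hΔ]; norm_num)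

/-- **RECORD `150282bh1` @ `3` with the image binder `hns` AND the Tamagawa binders DISCHARGED** — `missingUpperBoundAt_g150282bh1_3_tam` (file
`…RecordsSharpTam15`) with `hns` supplied by `notSurjThree_g150282bh1` (`n = 1`). Remaining displayed: named facts + schema, Cremona's `N`, `r_an = 0`,
the lattice-optimal datum with `3 ∤ c(D)`, the field, the twist numerics. Per pair; nothing booked; BSD is not proved by this.
[cite: Serre1972, §5.3] [cite: Jetchev2008, Cor. 1.5] [cite: Miller2011LMS, Def. 1.1] [cite: Cremona2006, Table 1 (Cremona label 150282bh1)] -/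
theorem missingUpperBoundAt_g150282bh1_3_img
    (hGZ : ∀ (N : ℕ) [NeZero N] (W : WeierstrassCurve ℚ) (K : Type) [Field K] [NumberField K],
      gross_zagier N W K)
    (hKo : ∀ (N : ℕ) [NeZero N] (W : WeierstrassCurve ℚ) (K : Type) [Field K] [NumberField K],
      kolyvagin N W K)
    (hMN : ∀ (N : ℕ) [NeZero N] (W : WeierstrassCurve ℚ) (K : Type) [Field K] [NumberField K],
      MatarNekovar2019.thm03_padicValNat_card_sha_le_of_irreducible N W K)
    (hGZK : rank_eq_analyticRank_of_analyticRank_le_one) (hmod : hasEntireLFunction_rat)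
    (hJ2 : ∀ (N : ℕ) [NeZero N] (W : WeierstrassCurve ℚ) [W.IsElliptic] [W.IsGloballyMinimal]
      (K : Type) [Field K] [NumberField K],
      IsImaginaryQuadratic K → NumberField.discr K ≠ -3 → NumberField.discr K ≠ -4 →
      SatisfiesHeegnerHypothesis N K → SatisfiesHeegnerHypothesis 2 K →
      ∀ (p : ℕ) [Fact p.Prime], p ≠ 2 → W.analyticRank = 0 → Addv W p → 0 ≤ padicValRat p W.j →
      ¬ W.HasCM → W.HasIrreducibleModPGaloisRep p →
      ¬ (∀ n : ℕ, W.HasSurjectiveModNGaloisRep (p ^ n : ℕ)) →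
      (∃ Dt : ModularParametrizationData W N,
        (∀ z ∈ Dt.L.lattice, ∃ w ∈ periodLattice Dt.f, z = (Dt.c : ℂ) * w) ∧ ¬ (p : ℤ) ∣ Dt.c) →
      ¬ p ∣ (W.baseChange ℚ_[p]).localTamagawaNumber ℤ_[p] →
      (∀ (q' : ℕ) [Fact q'.Prime], q' ∣ N →
        p ∣ (W.baseChange ℚ_[q']).localTamagawaNumber ℤ_[q'] → ¬ q' ^ 2 ∣ N) →
      ∀ {P : (W.baseChange K).toAffine.Point}, IsHeegnerPoint N W K P → ¬ IsOfFinAddOrder P →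
      ∀ (q : ℕ) [Fact q.Prime], q ∣ N → ¬ q ^ 2 ∣ N → q ≠ p →
      padicValNat p (Nat.card (AddCommGroup.primaryComponent (W.baseChange K).sha p)) +
          2 * padicValNat p ((W.baseChange ℚ_[q]).localTamagawaNumber ℤ_[q]) ≤
        2 * padicValNat p (AddSubgroup.zmultiples P).index)
    {W : WeierstrassCurve ℚ} [W.IsElliptic] [W.IsGloballyMinimal] (hWeq : W = (⟨1, (-1), 1, (-3762155), 2811486835⟩ : WeierstrassCurve ℚ))
    (hN : W.conductorNorm ℤ = 150282) (hr : W.analyticRank = 0)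
    (D : ModularParametrizationData W 150282) (hopt : ∀ z ∈ D.L.lattice, ∃ w ∈ periodLattice D.f, z = (D.c : ℂ) * w)
    (hc : ¬ (3 : ℤ) ∣ D.c)
    (K : Type) [Field K] [NumberField K] (hK : IsImaginaryQuadratic K) (hdK : NumberField.discr K = -743)
    {Wd : WeierstrassCurve ℚ} [Wd.IsElliptic] [Wd.IsGloballyMinimal] (hWdeq : Wd = (⟨1, (-1), 1, (-2076893733080), (-1152808020235361069)⟩ : WeierstrassCurve ℚ))
    (hrd : Wd.analyticRank = 1) {qd : ℚ} (hqd : shaAn Wd = (qd : ℂ)) (hvd : padicValRat 3 qd ≤ 0) :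
    MissingUpperBoundAt W 3 := by
  have hI : integralModelInt W = (⟨1, -1, 1, -3762155, 2811486835⟩ : WeierstrassCurve ℤ) := by
    subst hWeq; exact integralModelInt_eq_of_map_eq _ (map_mk_int 1 (-1) 1 (-3762155) 2811486835)
  have hns : ¬ (∀ n : ℕ, W.HasSurjectiveModNGaloisRep (3 ^ n : ℕ)) := fun h =>
    notSurjThree_g150282bh1 hI (by simpa using h 1)
  exact missingUpperBoundAt_g150282bh1_3_tam hGZ hKo hMN hGZK hmod hJ2 hWeq hN hr hns D hopt hc K hK hdK hWdeq hrd hqd hvd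

end Summit.BirchSwinnertonDyer.BirchSwinnertonDyer.Theorems.WildUpperUnitTwistRecords

end
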